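import Literature.ModelTheory.ExponentialFields.PointIdealGenerators
import Literature.RingTheory.KrullDimension.AffineCatenary
import Literature.RingTheory.KrullDimension.AffineDimension
import Mathlib.RingTheory.RegularLocalRing.Polynomial
import Mathlib.RingTheory.Ideal.Height
import Mathlib.RingTheory.KrullDimension.Polynomial
import Mathlib.Algebra.Module.SpanRank
import Mathlib.FieldTheory.IntermediateField.Adjoin.Algebra
import Mathlib.RingTheory.AlgebraicIndependent.TranscendenceBasis
import Mathlib.RingTheory.AlgebraicIndependent.Transcendental
import HarnessLib

/-!
# Proof of Jones–Servi's Proposition 3.8 at the point `(ā, e^{ā})`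

Family `periods` (periods.S27), topic `Literature/ModelTheory/ExponentialFields`: discharge of
the named fact `Literature.ModelTheory.ExponentialFields.JonesServi2011_pointIdealGenerators`
(`PointIdealGenerators.lean`, leaf (B3) of the conditional half of Macintyre–Wilkie's theorem).

With `A = ℚ[x₁…x_N, y₁…y_N]`, `𝔭 = {q : q(ā, e^{ā}) = 0}` (the kernel of the evaluation
`A → ℝ`, a prime ideal) and `r = trdeg_ℚ ℚ(ā, e^{ā})`:

1. `A ⧸ 𝔭 ≅ ℚ[ā, e^{ā}]`, whose fraction field is `ℚ(ā, e^{ā})`, so `trdeg_ℚ (A ⧸ 𝔭) = r`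
   (`trdeg_quotient_eq`);
2. the dimension formula for the affine domain `A` (`Literature.RingTheory.KrullDimension`:
   `dim (A ⧸ 𝔭) + ht 𝔭 = dim A = 2N`, `dim (A ⧸ 𝔭) = trdeg`) gives `ht 𝔭 + r = 2N`
   (`height_add_eq`);
3. polynomial rings over a field are regular (Mathlib `IsRegularRing`), so the local ring `A_𝔭`
   is regular of dimension `ht 𝔭`: its maximal ideal `𝔭A_𝔭` is generated by `2N − r` elements,
   which may be taken in `𝔭` and with integer coefficients (`exists_generators`);
4. clearing denominators (`A_𝔭 → A → ℤ[x̄, ȳ]`) and using finitely many generators of the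
   integer ideal of the point gives one `q₀ ∉ 𝔭` with `q₀ · q ∈ (M₁, …, M_s)` for every integer
   `q` vanishing at the point (`JonesServi2011_pointIdealGenerators_holds`).

## References

* G. O. Jones, T. Servi, *On the decidability of the real field with a generic power function*,
  J. Symb. Log. 76 (2011), Prop. 3.8.
* H. Matsumura, *Commutative Ring Theory* (1986), Thm. 5.6 (dimension of affine domains),
  §14, §19 (regular local rings).
-/

noncomputable section

open scoped BigOperators
open MvPolynomial

namespace Literature.ModelTheory.ExponentialFields

namespace PointIdeal

open ExpPoly

variable {N : ℕ} (a : Fin N → ℝ)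

/-- The rational polynomial ring `A = ℚ[x̄, ȳ]`. [folklore] -/
abbrev A (N : ℕ) : Type := MvPolynomial (Fin N ⊕ Fin N) ℚ

/-- The evaluation `A → ℝ` at the point `(ā, e^{ā})`. [folklore] -/
def φ : A N →ₐ[ℚ] ℝ := MvPolynomial.aeval (expPt a)

/-- The ideal `𝔭` of the point `(ā, e^{ā})` in `ℚ[x̄, ȳ]`. [folklore] -/
def 𝔭 : Ideal (A N) := RingHom.ker (φ a)

/-- `𝔭` is prime. [folklore] -/
instance isPrime_𝔭 : (𝔭 a).IsPrime := RingHom.ker_isPrime _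

/-- Membership in `𝔭`. [folklore] -/
theorem mem_𝔭_iff (q : A N) : q ∈ 𝔭 a ↔ MvPolynomial.aeval (expPt a) q = 0 := RingHom.mem_ker

/-- The field `ℚ(ā, e^{ā}) ⊆ ℝ`. [folklore] -/
abbrev K₀ : IntermediateField ℚ ℝ := IntermediateField.adjoin ℚ (Set.range a ∪ Set.range (Real.exp ∘ a))

/-- The ring `ℚ[ā, e^{ā}] ⊆ ℝ`. [folklore] -/
abbrev A₀ : Subalgebra ℚ ℝ := Algebra.adjoin ℚ (Set.range a ∪ Set.range (Real.exp ∘ a))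

/-- `range (ā, e^{ā}) = range ā ∪ range e^{ā}`. [folklore] -/
theorem range_expPt : Set.range (expPt a) = Set.range a ∪ Set.range (Real.exp ∘ a) :=
  Set.Sum.elim_range _ _

/-- The range of the evaluation is `ℚ[ā, e^{ā}]`. [folklore] -/
theorem range_φ : (φ a).range = A₀ a := by
  rw [φ, ← Algebra.adjoin_range_eq_range_aeval, range_expPt]

/-- `A ⧸ 𝔭 ≃ ℚ[ā, e^{ā}]`. [folklore] -/
def quotientEquiv : (A N ⧸ 𝔭 a) ≃ₐ[ℚ] A₀ a :=
  ((Ideal.quotientEquivAlgOfEq ℚ (by rw [𝔭, AlgHom.ker_rangeRestrict])).trans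
    (Ideal.quotientKerAlgEquivOfSurjective (AlgHom.rangeRestrict_surjective (φ a)))).trans
    (Subalgebra.equivOfEq _ _ (range_φ a))

open IntermediateField.algebraAdjoinAdjoin in
/-- **`trdeg_ℚ (A ⧸ 𝔭) = trdeg_ℚ ℚ(ā, e^{ā})`.** [folklore] -/
theorem trdeg_quotient_eq : Algebra.trdeg ℚ (A N ⧸ 𝔭 a) = Algebra.trdeg ℚ (K₀ a) := by
  rw [(quotientEquiv a).trdeg_eq]
  have h := trdeg_add_eq ℚ (A₀ a) (A := K₀ a)
  rw [trdeg_eq_zero (R := A₀ a) (A := K₀ a), add_zero] at h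
  exact h

/-- The affine domain `A ⧸ 𝔭` is of finite type. [folklore] -/
instance finiteType_quotient : Algebra.FiniteType ℚ (A N ⧸ 𝔭 a) := inferInstance

/-- `trdeg_ℚ ℚ(ā, e^{ā})` is a natural number `r` with **`ht 𝔭 + r = 2N`**. [folklore] -/
theorem height_add_eq : ∃ r : ℕ, Algebra.trdeg ℚ (K₀ a) = r ∧ (𝔭 a).height + r = (N + N : ℕ) := by
  obtain ⟨r, hdim, htr⟩ := Literature.RingTheory.KrullDimension.exists_ringKrullDim_eq_and_trdeg_eq ℚ (A N ⧸ 𝔭 a)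
  refine ⟨r, by rw [← trdeg_quotient_eq, htr], ?_⟩
  have h := Literature.RingTheory.KrullDimension.ringKrullDim_quotient_add_height ℚ (𝔭 a)
  rw [hdim, MvPolynomial.ringKrullDim_of_isNoetherianRing, ringKrullDim_eq_zero_of_field, zero_add,
    Nat.card_sum, Nat.card_eq_fintype_card, Fintype.card_fin] at h
  -- `h : (r : WithBot ℕ∞) + ↑(height) = ↑(N + N)`
  have h' : ((r : ℕ∞) : WithBot ℕ∞) + ((𝔭 a).height : WithBot ℕ∞) = (((N + N : ℕ) : ℕ∞) : WithBot ℕ∞) := by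
    simpa only [WithBot.coe_natCast] using h
  rw [← WithBot.coe_add, WithBot.coe_eq_coe] at h'
  have h'' : (r : ℕ∞) + (𝔭 a).height = (N + N : ℕ) := h'
  have hfin : (𝔭 a).height ≠ ⊤ := by
    intro htop; rw [htop, add_top] at h''; exact ENat.coe_ne_top _ h''.symm
  obtain ⟨m, hm⟩ := ENat.ne_top_iff_exists.1 hfin
  rw [← hm] at h'' ⊢
  have : r + m = N + N := by exact_mod_cast h''
  exact_mod_cast (show m + r = N + N by omega)

/-! ### Integer models of rational polynomials -/

/-- **Clearing denominators**: every `P ∈ ℚ[σ]` is `D⁻¹ P'` with `P' ∈ ℤ[σ]`, `D ∈ ℤ ∖ {0}`. [folklore] -/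
theorem exists_int_model {σ : Type*} (P : MvPolynomial σ ℚ) :
    ∃ (D : ℤ) (P' : MvPolynomial σ ℤ), D ≠ 0 ∧ MvPolynomial.map (Int.castRingHom ℚ) P' = C (D : ℚ) * P := by
  classical
  set D : ℤ := ∏ m ∈ P.support, ((P.coeff m).den : ℤ) with hD
  have hD0 : D ≠ 0 := Finset.prod_ne_zero_iff.2 fun m _ => by exact_mod_cast (P.coeff m).den_nz
  -- `D · coeff` is an integer
  have hint : ∀ m, ∃ z : ℤ, (D : ℚ) * P.coeff m = z := by
    intro m
    by_cases hm : m ∈ P.support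
    · obtain ⟨E, hE⟩ : ((P.coeff m).den : ℤ) ∣ D := Finset.dvd_prod_of_mem _ hm
      refine ⟨E * (P.coeff m).num, ?_⟩
      rw [hE]
      push_cast
      have := Rat.mul_den_eq_num (P.coeff m)
      calc ((P.coeff m).den : ℚ) * E * P.coeff m = E * (P.coeff m * (P.coeff m).den) := by ring
        _ = E * (P.coeff m).num := by rw [this]
    · rw [MvPolynomial.notMem_support_iff.1 hm, mul_zero]
      exact ⟨0, by simp⟩
  choose z hz using hint
  refine ⟨D, ∑ m ∈ P.support, monomial m (z m), hD0, ?_⟩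
  rw [map_sum]
  conv_rhs => rw [P.as_sum, Finset.mul_sum]
  refine Finset.sum_congr rfl fun m _ => ?_
  rw [map_monomial, C_mul_monomial, eq_intCast, ← hz m]

/-- Clearing denominators for a finite family, with one common denominator. [folklore] -/
theorem exists_int_models {σ : Type*} {ι : Type*} [Fintype ι] (P : ι → MvPolynomial σ ℚ) :
    ∃ (D : ℤ) (P' : ι → MvPolynomial σ ℤ), D ≠ 0 ∧ ∀ i, MvPolynomial.map (Int.castRingHom ℚ) (P' i) = C (D : ℚ) * P i := by
  classical
  choose D P' hD hP using fun i => exists_int_model (P i)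
  refine ⟨∏ i, D i, fun i => C (∏ j ∈ Finset.univ.erase i, D j) * P' i, Finset.prod_ne_zero_iff.2 fun i _ => hD i, fun i => ?_⟩
  rw [map_mul, map_C, hP i, ← mul_assoc, ← C_mul, eq_intCast, ← Finset.prod_erase_mul _ _ (Finset.mem_univ i)]
  push_cast
  ring

/-- The evaluation at the point of an integer polynomial, through `ℚ`. [folklore] -/
theorem aeval_map_int (q : MvPolynomial (Fin N ⊕ Fin N) ℤ) :
    MvPolynomial.aeval (expPt a) (MvPolynomial.map (Int.castRingHom ℚ) q) = expEval q a := by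
  rw [expEval, ← MvPolynomial.aeval_map_algebraMap ℚ (expPt a) q]
  rfl

/-- Integer polynomials vanishing at the point map into `𝔭`. [folklore] -/
theorem map_mem_𝔭_iff (q : MvPolynomial (Fin N ⊕ Fin N) ℤ) :
    MvPolynomial.map (Int.castRingHom ℚ) q ∈ 𝔭 a ↔ expEval q a = 0 := by
  rw [mem_𝔭_iff, aeval_map_int]

/-! ### The local ring at the point and generators of its maximal ideal -/

/-- The local ring `A_𝔭`. [folklore] -/
abbrev L : Type := Localization.AtPrime (𝔭 a)

/-- `A_𝔭` is a regular local ring (polynomial rings over a field are regular). [folklore] -/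
instance isRegularLocalRing_L : IsRegularLocalRing (L a) := inferInstance

/-- `A → A_𝔭` is injective (`A` is a domain). [folklore] -/
theorem algebraMap_L_injective : Function.Injective (algebraMap (A N) (L a)) :=
  IsLocalization.injective (L a) (Ideal.primeCompl_le_nonZeroDivisors (𝔭 a))

/-- **The maximal ideal of `A_𝔭` is generated by `2N − r` integer polynomials of `𝔭`**
(regularity: `μ(𝔪) = dim A_𝔭 = ht 𝔭 = 2N − r`; numerators of generators, scaled to integer
coefficients). [folklore] -/
theorem exists_generators : ∃ (r t : ℕ), Algebra.trdeg ℚ (K₀ a) = r ∧ t + r = N + N ∧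
    ∃ p : Fin t → MvPolynomial (Fin N ⊕ Fin N) ℤ, (∀ j, expEval (p j) a = 0) ∧
      Ideal.span (Set.range fun j => algebraMap (A N) (L a) (MvPolynomial.map (Int.castRingHom ℚ) (p j))) =
        IsLocalRing.maximalIdeal (L a) := by
  classical
  obtain ⟨r, hr, hh⟩ := height_add_eq a
  -- the number of generators
  have hspan : ((IsLocalRing.maximalIdeal (L a)).spanFinrank : WithBot ℕ∞) = ((𝔭 a).height : WithBot ℕ∞) := by
    rw [IsRegularLocalRing.spanFinrank_maximalIdeal, IsLocalization.AtPrime.ringKrullDim_eq_height (𝔭 a) (L a)]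
  have hfin : (𝔭 a).height ≠ ⊤ := fun htop => by
    rw [htop, top_add] at hh; exact ENat.top_ne_coe _ hh
  obtain ⟨m, hm⟩ := ENat.ne_top_iff_exists.1 hfin
  have ht : (IsLocalRing.maximalIdeal (L a)).spanFinrank = m := by
    rw [← hm] at hspan; exact_mod_cast hspan
  have htr : m + r = N + N := by rw [← hm] at hh; exact_mod_cast hh
  -- a generating finset of that size
  obtain ⟨s, hscard, hsspan⟩ := Submodule.FG.exists_span_finset_card_eq_spanFinrank
    (IsNoetherian.noetherian (IsLocalRing.maximalIdeal (L a)))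
  rw [ht] at hscard
  let e : s ≃ Fin m := s.equivFin.trans (finCongr hscard)
  -- numerators in `𝔭`
  have hnum : ∀ x : L a, x ∈ IsLocalRing.maximalIdeal (L a) →
      ∃ (q : A N) (u : (𝔭 a).primeCompl), q ∈ 𝔭 a ∧ IsLocalization.mk' (L a) q u = x := by
    intro x hx
    obtain ⟨⟨q, u⟩, rfl⟩ := IsLocalization.mk'_surjective (𝔭 a).primeCompl x
    exact ⟨q, u, (IsLocalization.AtPrime.mk'_mem_maximal_iff (L a) (𝔭 a) q u).1 hx, rfl⟩
  have hmem : ∀ j : Fin m, (e.symm j : L a) ∈ IsLocalRing.maximalIdeal (L a) := fun j => by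
    rw [← hsspan]; exact Submodule.subset_span (e.symm j).2
  choose q u hq hqu using fun j : Fin m => hnum _ (hmem j)
  -- integer models of the numerators
  obtain ⟨D, p, hD, hp⟩ := exists_int_models q
  have hunit_D : IsUnit (algebraMap (A N) (L a) (C (D : ℚ))) :=
    ((isUnit_iff_ne_zero.2 (Int.cast_ne_zero.2 hD) : IsUnit ((D : ℤ) : ℚ)).map MvPolynomial.C).map _
  refine ⟨r, m, hr, htr, p, fun j => ?_, ?_⟩
  · rw [← map_mem_𝔭_iff, hp j]
    exact Ideal.mul_mem_left _ _ (hq j)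
  · apply le_antisymm
    · rw [Ideal.span_le]
      rintro _ ⟨j, rfl⟩
      dsimp only
      rw [hp j, map_mul, SetLike.mem_coe]
      refine Ideal.mul_mem_left _ _ ?_
      exact (IsLocalization.AtPrime.to_map_mem_maximal_iff (L a) (𝔭 a) (q j)).2 (hq j)
    · rw [← hsspan, Ideal.span_le]
      intro x hx
      set j := e ⟨x, hx⟩ with hj
      have hxj : (e.symm j : L a) = x := by rw [hj, Equiv.symm_apply_apply]
      have hunit_u : IsUnit (algebraMap (A N) (L a) (u j : A N)) := IsLocalization.map_units (L a) (u j)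
      -- `algebraMap (D q_j) = D · (x · u_j)`
      have key : algebraMap (A N) (L a) (MvPolynomial.map (Int.castRingHom ℚ) (p j)) =
          hunit_D.unit * (x * hunit_u.unit) := by
        rw [hp j, map_mul, IsUnit.unit_spec, IsUnit.unit_spec, ← hxj, ← hqu j, IsLocalization.mk'_spec]
      have hx_eq : x = algebraMap (A N) (L a) (MvPolynomial.map (Int.castRingHom ℚ) (p j)) *
          (((hunit_D.unit⁻¹ : (L a)ˣ) : L a) * ((hunit_u.unit⁻¹ : (L a)ˣ) : L a)) := by
        rw [key]
        calc x = (((hunit_D.unit⁻¹ : (L a)ˣ) : L a) * hunit_D.unit) * x *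
              ((hunit_u.unit : L a) * ((hunit_u.unit⁻¹ : (L a)ˣ) : L a)) := by
                rw [Units.inv_mul, Units.mul_inv, one_mul, mul_one]
          _ = (hunit_D.unit : L a) * (x * hunit_u.unit) *
              (((hunit_D.unit⁻¹ : (L a)ˣ) : L a) * ((hunit_u.unit⁻¹ : (L a)ˣ) : L a)) := by ring
      rw [SetLike.mem_coe, hx_eq]
      exact Ideal.mul_mem_right _ _ (Ideal.subset_span ⟨j, rfl⟩)

/-! ### Clearing denominators: from `A_𝔭` to `A` -/

/-- **Every `q ∈ 𝔭` lies in `(g₁, …, g_t)` after multiplication by some `u ∉ 𝔭`**, when the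
`gⱼ ∈ A` generate the maximal ideal of `A_𝔭`. [folklore] -/
theorem exists_mul_mem_span {t : ℕ} (g : Fin t → A N)
    (hg : Ideal.span (Set.range fun j => algebraMap (A N) (L a) (g j)) = IsLocalRing.maximalIdeal (L a))
    {q : A N} (hq : q ∈ 𝔭 a) :
    ∃ (u : A N) (c : Fin t → A N), u ∉ 𝔭 a ∧ u * q = ∑ j, c j * g j := by
  have hmap : Ideal.map (algebraMap (A N) (L a)) (Ideal.span (Set.range g)) = IsLocalRing.maximalIdeal (L a) := by
    rw [Ideal.map_span, ← Set.range_comp, ← hg]; rfl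
  have hqL : algebraMap (A N) (L a) q ∈ Ideal.map (algebraMap (A N) (L a)) (Ideal.span (Set.range g)) := by
    rw [hmap]; exact (IsLocalization.AtPrime.to_map_mem_maximal_iff (L a) (𝔭 a) q).2 hq
  obtain ⟨⟨⟨i, hi⟩, u⟩, hiu⟩ := (IsLocalization.mem_map_algebraMap_iff (𝔭 a).primeCompl (L a)).1 hqL
  -- `algebraMap (q * u) = algebraMap i`
  have heq : q * (u : A N) = i := algebraMap_L_injective a (by rw [map_mul]; exact hiu)
  obtain ⟨c, hc⟩ := (Ideal.mem_span_range_iff_exists_fun).1 hi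
  exact ⟨u, c, u.2, by rw [mul_comm, heq, ← hc]⟩

/-! ### The integer ideal of the point and the uniform denominator -/

/-- The integer ideal of the point: `{q ∈ ℤ[x̄, ȳ] : q(ā, e^{ā}) = 0}`. [folklore] -/
def 𝔭ℤ : Ideal (MvPolynomial (Fin N ⊕ Fin N) ℤ) :=
  RingHom.ker (MvPolynomial.aeval (expPt a) : MvPolynomial (Fin N ⊕ Fin N) ℤ →ₐ[ℤ] ℝ)

/-- Membership in the integer ideal of the point. [folklore] -/
theorem mem_𝔭ℤ_iff (q : MvPolynomial (Fin N ⊕ Fin N) ℤ) : q ∈ 𝔭ℤ a ↔ expEval q a = 0 := RingHom.mem_ker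

/-- **Integer identities with a uniform multiplier**: there are integer polynomials
`M₁, …, M_t ∈ 𝔭` (`t = 2N − r`) and `q₀` with `q₀(ā, e^{ā}) ≠ 0` such that
`q₀ · q ∈ (M₁, …, M_t)ℤ[x̄, ȳ]` for every integer `q` vanishing at the point. [folklore] -/
theorem exists_uniform : ∃ (r t : ℕ), Algebra.trdeg ℚ (K₀ a) = r ∧ t + r = N + N ∧
    ∃ (M : Fin t → MvPolynomial (Fin N ⊕ Fin N) ℤ) (q₀ : MvPolynomial (Fin N ⊕ Fin N) ℤ),
      (∀ j, expEval (M j) a = 0) ∧ expEval q₀ a ≠ 0 ∧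
        ∀ q : MvPolynomial (Fin N ⊕ Fin N) ℤ, expEval q a = 0 →
          ∃ b : Fin t → MvPolynomial (Fin N ⊕ Fin N) ℤ, q₀ * q = ∑ j, b j * M j := by
  classical
  obtain ⟨r, t, hr, htr, p, hp0, hspan⟩ := exists_generators a
  refine ⟨r, t, hr, htr, p, ?_⟩
  -- generators of the integer ideal
  obtain ⟨t', g, hg⟩ := Submodule.fg_iff_exists_fin_generating_family.1
    (IsNoetherian.noetherian (𝔭ℤ a) : (𝔭ℤ a).FG)
  -- for each generator: `uᵢ gᵢ = Σ cᵢⱼ pⱼ` over `ℚ`, then over `ℤ`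
  have hgi : ∀ i, MvPolynomial.map (Int.castRingHom ℚ) (g i) ∈ 𝔭 a := fun i => by
    rw [map_mem_𝔭_iff, ← mem_𝔭ℤ_iff, ← hg]
    exact Ideal.subset_span ⟨i, rfl⟩
  choose u c hu huc using fun i => exists_mul_mem_span a (fun j => MvPolynomial.map (Int.castRingHom ℚ) (p j)) hspan (hgi i)
  -- common denominators for `(uᵢ, cᵢⱼ)ⱼ`
  have hden : ∀ i, ∃ (D : ℤ) (U : MvPolynomial (Fin N ⊕ Fin N) ℤ) (Cc : Fin t → MvPolynomial (Fin N ⊕ Fin N) ℤ),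
      D ≠ 0 ∧ MvPolynomial.map (Int.castRingHom ℚ) U = C (D : ℚ) * u i ∧
        ∀ j, MvPolynomial.map (Int.castRingHom ℚ) (Cc j) = C (D : ℚ) * c i j := by
    intro i
    obtain ⟨D, P', hD, hP'⟩ := exists_int_models (fun o : Option (Fin t) => o.elim (u i) (c i))
    exact ⟨D, P' none, fun j => P' (some j), hD, hP' none, fun j => hP' (some j)⟩
  choose D U Cc hD hU hCc using hden
  -- integer identities `Uᵢ gᵢ = Σⱼ Ccᵢⱼ pⱼ`
  have hidZ : ∀ i, U i * g i = ∑ j, Cc i j * p j := fun i => by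
    apply MvPolynomial.map_injective (Int.castRingHom ℚ) Int.cast_injective
    rw [map_mul, hU i, map_sum, mul_assoc, huc i, Finset.mul_sum]
    refine Finset.sum_congr rfl fun j _ => ?_
    rw [map_mul, hCc i j, mul_assoc]
  -- the multiplier
  refine ⟨∏ i, U i, hp0, ?_, ?_⟩
  · rw [expEval, map_prod]
    refine Finset.prod_ne_zero_iff.2 fun i _ => ?_
    rw [← expEval, ← aeval_map_int, hU i, map_mul, MvPolynomial.aeval_C, eq_ratCast]
    refine mul_ne_zero (by exact_mod_cast hD i) ?_
    exact fun h0 => hu i ((mem_𝔭_iff a _).2 h0)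
  · intro q hq
    have hg' : Ideal.span (Set.range g) = 𝔭ℤ a := hg
    have hq' : q ∈ Ideal.span (Set.range g) := by rw [hg', mem_𝔭ℤ_iff]; exact hq
    obtain ⟨e, he⟩ := (Ideal.mem_span_range_iff_exists_fun).1 hq'
    refine ⟨fun j => ∑ i, e i * (∏ i' ∈ Finset.univ.erase i, U i') * Cc i j, ?_⟩
    calc (∏ i, U i) * q = ∑ i, e i * (∏ i' ∈ Finset.univ.erase i, U i') * (U i * g i) := by
          rw [← he, Finset.mul_sum]
          refine Finset.sum_congr rfl fun i _ => ?_
          rw [← Finset.prod_erase_mul _ _ (Finset.mem_univ i)]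
          ring
      _ = ∑ i, ∑ j, e i * (∏ i' ∈ Finset.univ.erase i, U i') * Cc i j * p j := by
          refine Finset.sum_congr rfl fun i _ => ?_
          rw [hidZ i, Finset.mul_sum]
          exact Finset.sum_congr rfl fun j _ => by ring
      _ = ∑ j, (∑ i, e i * (∏ i' ∈ Finset.univ.erase i, U i') * Cc i j) * p j := by
          rw [Finset.sum_comm]
          exact Finset.sum_congr rfl fun j _ => by rw [Finset.sum_mul]

/-! ### Padding to `s` generators and the named fact -/

/-- Sums over `Fin s` of a family supported on the first `t ≤ s` indices. [folklore] -/
theorem sum_dite_lt {R : Type*} [AddCommMonoid R] {t s : ℕ} (hts : t ≤ s) (f : Fin t → R) :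
    (∑ l : Fin s, if h : (l : ℕ) < t then f ⟨l, h⟩ else 0) = ∑ j : Fin t, f j := by
  set F : ℕ → R := fun k => if h : k < t then f ⟨k, h⟩ else 0 with hF
  have h1 : (∑ l : Fin s, if h : (l : ℕ) < t then f ⟨l, h⟩ else 0) = ∑ k ∈ Finset.range s, F k :=
    Fin.sum_univ_eq_sum_range F s
  have h2 : (∑ j : Fin t, f j) = ∑ k ∈ Finset.range t, F k := by
    rw [← Fin.sum_univ_eq_sum_range F t]
    exact Finset.sum_congr rfl fun j _ => by simp [hF, j.is_lt]
  rw [h1, h2, ← Finset.sum_range_add_sum_Ico _ hts,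
    Finset.sum_eq_zero (s := Finset.Ico t s) fun k hk => ?_, add_zero]
  rw [hF]
  exact dif_neg (not_lt.2 (Finset.mem_Ico.1 hk).1)

/-- **Jones–Servi's Proposition 3.8 at the point `(ā, e^{ā})` holds.** [cite: JonesServi2011, Prop. 3.8] -/
theorem pointIdealGenerators (s : ℕ)
    (hs : ((N + N : ℕ) : Cardinal) ≤ (s : Cardinal) + Algebra.trdeg ℚ (K₀ a)) :
    ∃ (q₀ : MvPolynomial (Fin N ⊕ Fin N) ℤ) (M : Fin s → MvPolynomial (Fin N ⊕ Fin N) ℤ),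
      expEval q₀ a ≠ 0 ∧ (∀ l, expEval (M l) a = 0) ∧
        ∀ q : MvPolynomial (Fin N ⊕ Fin N) ℤ, expEval q a = 0 →
          ∃ (k : ℕ) (b : Fin s → MvPolynomial (Fin N ⊕ Fin N) ℤ), q₀ ^ k * q = ∑ l, b l * M l := by
  obtain ⟨r, t, hr, htr, M, q₀, hM, hq₀, hgen⟩ := exists_uniform a
  have hts : t ≤ s := by
    rw [hr, ← Nat.cast_add, Nat.cast_le] at hs
    omega
  refine ⟨q₀, fun l => if h : (l : ℕ) < t then M ⟨l, h⟩ else 0, hq₀, fun l => ?_, fun q hq => ?_⟩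
  · dsimp only
    by_cases h : (l : ℕ) < t
    · rw [dif_pos h]; exact hM _
    · rw [dif_neg h, expEval, map_zero]
  · obtain ⟨b, hb⟩ := hgen q hq
    refine ⟨1, fun l => if h : (l : ℕ) < t then b ⟨l, h⟩ else 0, ?_⟩
    rw [pow_one, hb, ← sum_dite_lt hts (fun j => b j * M j)]
    refine Finset.sum_congr rfl fun l _ => ?_
    dsimp only
    by_cases h : (l : ℕ) < t
    · rw [dif_pos h, dif_pos h, dif_pos h]
    · rw [dif_neg h, dif_neg h, dif_neg h, mul_zero]

end PointIdeal

/-- **The named fact (B3) holds**: Jones–Servi's Proposition 3.8 at the point `(ā, e^{ā})`. [cite: JonesServi2011, Prop. 3.8] -/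
theorem JonesServi2011_pointIdealGenerators_holds : JonesServi2011_pointIdealGenerators :=
  fun _ s a hs => PointIdeal.pointIdealGenerators a s hs

end Literature.ModelTheory.ExponentialFields

end
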